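import Mathlib
import Summits.Ventures.PercRepro2.CutVertexPieceBBE

/-!
# The cut vertex separating the roots, V: the piece `CCC` in the kernel (blind cell PercRepro2,
p3 g2, 2026-08-25; `proofs/P3-BRIDGE.md` §10.9 — the BHK 1.4 pilot)

`Wt C C C = 2 P(Q) · [BHK14(b₁, o_c) + BHK14(o₁, b_c)]` with `Q = {a₁ ↮ c}` and
`BHK14(U, V′) = P(Q ∩ U) P(Q ∩ V′) − P(Q) P(Q ∩ U ∩ V′)` the cross-cluster slack of BHK06 Thm 1.4 for
the root pair `(a₁, c)` (`bhk_cross_cluster_avoid` with `X = {c}`); hence `Wsym C C C = 6 · Wt C C C ≥ 0`.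
The kernel `Kt C C C = 2 q(x) q(y) q(z) [b₁(y) o_c(z) + b_c(y) o₁(z) − (o₁ b_c)(z) − (o_c b₁)(z)]`,
`q = 1 − 1[a₁ ~ c]` (`simp` on the glued states); the cubic form factorises (`triple_sum_sep`); the
`l`-state coordinates are the cluster indicators of the glued graph and `q` is the indicator of
`avoidAll a₁ {c}`.  Own work; standard axioms.
-/

namespace Summit.Ventures.PercRepro2

open UnionCluster

namespace CovForm

namespace RootBridge

open OneTyped

section PieceCCC

open Classical

variable {V : Type*} {E : Type*} [Fintype E] [DecidableEq E] [Fintype V] [DecidableEq V] {R : Type*}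
  [Field R] [LinearOrder R] [IsStrictOrderedRing R]
variable (p : E → R) (ends : E → Sym2 V) (o a₁ a₂ a₃ b c : V) (VL VH : Set V)

omit [Fintype E] [DecidableEq E] [Fintype V] [DecidableEq V] [LinearOrder R] [IsStrictOrderedRing R] in
/-- `Kt C C C` on `l`-states. -/
lemma Kt_CCC (l₁ l₂ l₃ : LSt) : (Kt HState.C HState.C HState.C l₁ l₂ l₃ : R) =
    2 * ((if l₁.1 then (0 : R) else 1) * ((if l₂.1 then (0 : R) else 1) * (if l₃.1 then (0 : R) else 1))) *
      ((if l₂.2.2.1 then (1 : R) else 0) * (if l₃.2.2.2.1 then (1 : R) else 0) +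
        (if l₂.2.2.2.2 then (1 : R) else 0) * (if l₃.2.1 then (1 : R) else 0) -
        (if l₃.2.1 then (1 : R) else 0) * (if l₃.2.2.2.2 then (1 : R) else 0) -
        (if l₃.2.2.2.1 then (1 : R) else 0) * (if l₃.2.2.1 then (1 : R) else 0)) := by
  simp [Kt, KB, gluedSt, qB, pdB, sigB, uB, St.q', St.Lo, St.Ho, St.Lb, St.Hb, St.L3, St.H3,
    HState.hv, HState.h3, HState.v3, LSt.al, LSt.o1, LSt.b1, LSt.oc, LSt.bc]
  split_ifs <;> ring

/-- The indicator of `Q = {a₁ ↮ c}`. -/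
noncomputable def iQc (x : Config E) : R := (avoidAll ends a₁ {c}).indicator 1 x

omit [Fintype E] [DecidableEq E] [Fintype V] [DecidableEq V] [LinearOrder R] [IsStrictOrderedRing R] in
/-- `1[a₁ ↮ c]` read off the `l`-state. -/
lemma lst_q_eq {VL VH : Set V} (h : CutVertex ends o a₁ a₂ a₃ b c VL VH) (x : Config E) :
    (if (lstC ends o a₁ b c VL x).1 then (0 : R) else 1) = iQc ends a₁ c x := by
  have hsp : ∀ e, x e = true → e ∈ within ends VL ∨ e ∈ within ends VH := fun e _ => h.split e
  have e1 := conn_side ends hsp h.cap h.a1L h.cL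
  unfold lstC iQc
  simp only [Set.indicator_apply, mem_avoidAll, Finset.mem_singleton, forall_eq, Pi.one_apply]
  rw [decide_eq_decide.mpr e1.symm]
  · by_cases hc : Conn ends x a₁ c <;> simp [hc]
  all_goals infer_instance

omit [Fintype E] [DecidableEq E] [Fintype V] [DecidableEq V] [LinearOrder R] [IsStrictOrderedRing R] in
/-- `1[o ∈ C(c)]` read off the `l`-state. -/
lemma lst_oc_eq {VL VH : Set V} (h : CutVertex ends o a₁ a₂ a₃ b c VL VH) (x : Config E) :
    (if (lstC ends o a₁ b c VL x).2.2.2.1 then (1 : R) else 0) = iL ends c o x := by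
  have hsp : ∀ e, x e = true → e ∈ within ends VL ∨ e ∈ within ends VH := fun e _ => h.split e
  have e3 := conn_side ends hsp h.cap h.cL h.oL
  unfold lstC iL
  simp only [Set.indicator_apply, mem_connEvent, Pi.one_apply]
  rw [decide_eq_decide.mpr e3.symm]
  · by_cases hc : Conn ends x c o <;> simp [hc]
  all_goals infer_instance

omit [Fintype E] [DecidableEq E] [Fintype V] [DecidableEq V] [LinearOrder R] [IsStrictOrderedRing R] in
/-- `1[b ∈ C(c)]` read off the `l`-state. -/
lemma lst_bc_eq {VL VH : Set V} (h : CutVertex ends o a₁ a₂ a₃ b c VL VH) (x : Config E) :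
    (if (lstC ends o a₁ b c VL x).2.2.2.2 then (1 : R) else 0) = iL ends c b x := by
  have hsp : ∀ e, x e = true → e ∈ within ends VL ∨ e ∈ within ends VH := fun e _ => h.split e
  have e5 := conn_side ends hsp h.cap h.cL h.bL
  unfold lstC iL
  simp only [Set.indicator_apply, mem_connEvent, Pi.one_apply]
  rw [decide_eq_decide.mpr e5.symm]
  · by_cases hc : Conn ends x c b <;> simp [hc]
  all_goals infer_instance

omit [Fintype E] [DecidableEq E] [Fintype V] [DecidableEq V] [LinearOrder R] [IsStrictOrderedRing R] in
/-- Products of indicators are indicators of intersections (three factors). -/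
lemma indicator_inter_three (A B C : Set (Config E)) :
    (fun x => A.indicator (1 : Config E → R) x * (B.indicator 1 x * C.indicator 1 x)) =
      (A ∩ B ∩ C).indicator (1 : Config E → R) := by
  funext x
  rw [indicator_inter_one, indicator_inter_one, mul_assoc]

omit [Fintype V] [DecidableEq V] [LinearOrder R] [IsStrictOrderedRing R] in
/-- **`Wt C C C = 2 P(Q)[BHK14(b₁,o_c) + BHK14(o₁,b_c)]`** (as probabilities of intersections). -/
lemma Wt_CCC_eq {VL VH : Set V} (h : CutVertex ends o a₁ a₂ a₃ b c VL VH) :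
    Wt p ends o a₁ b c VL HState.C HState.C HState.C =
      2 * prob p (avoidAll ends a₁ {c}) *
        (prob p (avoidAll ends a₁ {c} ∩ connEvent ends a₁ b) *
            prob p (avoidAll ends a₁ {c} ∩ connEvent ends c o) +
          prob p (avoidAll ends a₁ {c} ∩ connEvent ends c b) *
            prob p (avoidAll ends a₁ {c} ∩ connEvent ends a₁ o) -
          prob p (avoidAll ends a₁ {c}) *
            prob p (avoidAll ends a₁ {c} ∩ connEvent ends a₁ o ∩ connEvent ends c b) -
          prob p (avoidAll ends a₁ {c}) *
            prob p (avoidAll ends a₁ {c} ∩ connEvent ends c o ∩ connEvent ends a₁ b)) := by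
  unfold Wt
  set I : Config E → R := iQc ends a₁ c with hI
  have e : ∀ x y z : Config E, weight p x * weight p y * weight p z *
      Kt HState.C HState.C HState.C (lstC ends o a₁ b c VL x) (lstC ends o a₁ b c VL y)
        (lstC ends o a₁ b c VL z) =
      weight p x * weight p y * weight p z *
        ((fun x => 2 * I x) x * ((I y * iL ends a₁ b y) * (I z * iL ends c o z))) +
      weight p x * weight p y * weight p z *
        ((fun x => 2 * I x) x * ((I y * iL ends c b y) * (I z * iL ends a₁ o z))) -
      weight p x * weight p y * weight p z *
        ((fun x => 2 * I x) x * (I y * (I z * (iL ends a₁ o z * iL ends c b z)))) -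
      weight p x * weight p y * weight p z *
        ((fun x => 2 * I x) x * (I y * (I z * (iL ends c o z * iL ends a₁ b z)))) := by
    intro x y z
    rw [Kt_CCC, lst_q_eq ends o a₁ a₂ a₃ b c h x, lst_q_eq ends o a₁ a₂ a₃ b c h y,
      lst_q_eq ends o a₁ a₂ a₃ b c h z, lst_b1_eq ends o a₁ a₂ a₃ b c h y,
      lst_oc_eq ends o a₁ a₂ a₃ b c h z, lst_bc_eq ends o a₁ a₂ a₃ b c h y,
      lst_o1_eq ends o a₁ a₂ a₃ b c h z, lst_bc_eq ends o a₁ a₂ a₃ b c h z,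
      lst_b1_eq ends o a₁ a₂ a₃ b c h z]
    ring
  simp only [e, Finset.sum_add_distrib, Finset.sum_sub_distrib]
  rw [triple_sum_sep, triple_sum_sep, triple_sum_sep, triple_sum_sep]
  have h0 : expect p (fun x => 2 * I x) = 2 * expect p I := expect_const_mul p 2 I
  have h1 : (fun y => I y * iL ends a₁ b y) =
      (avoidAll ends a₁ {c} ∩ connEvent ends a₁ b).indicator (1 : Config E → R) := by
    funext y; rw [hI]; unfold iQc iL; rw [indicator_inter_one]
  have h2 : (fun z => I z * iL ends c o z) =
      (avoidAll ends a₁ {c} ∩ connEvent ends c o).indicator (1 : Config E → R) := by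
    funext z; rw [hI]; unfold iQc iL; rw [indicator_inter_one]
  have h3 : (fun y => I y * iL ends c b y) =
      (avoidAll ends a₁ {c} ∩ connEvent ends c b).indicator (1 : Config E → R) := by
    funext y; rw [hI]; unfold iQc iL; rw [indicator_inter_one]
  have h4 : (fun z => I z * iL ends a₁ o z) =
      (avoidAll ends a₁ {c} ∩ connEvent ends a₁ o).indicator (1 : Config E → R) := by
    funext z; rw [hI]; unfold iQc iL; rw [indicator_inter_one]
  have h5 : (fun z => I z * (iL ends a₁ o z * iL ends c b z)) =
      (avoidAll ends a₁ {c} ∩ connEvent ends a₁ o ∩ connEvent ends c b).indicator (1 : Config E → R) := by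
    rw [hI]; unfold iQc iL; exact indicator_inter_three _ _ _
  have h6 : (fun z => I z * (iL ends c o z * iL ends a₁ b z)) =
      (avoidAll ends a₁ {c} ∩ connEvent ends c o ∩ connEvent ends a₁ b).indicator (1 : Config E → R) := by
    rw [hI]; unfold iQc iL; exact indicator_inter_three _ _ _
  rw [h0, h1, h2, h3, h4, h5, h6]
  simp only [prob_eq_expect_indicator]
  rw [hI]
  unfold iQc
  ring

/-- **The symmetrised piece `{C, C, C}` is nonnegative** (BHK 1.4 for the root pair `(a₁, c)`, twice). -/
theorem Wsym_CCC_nonneg (hp : IsProbVec p) {VL VH : Set V}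
    (h : CutVertex ends o a₁ a₂ a₃ b c VL VH) :
    0 ≤ Wsym p ends o a₁ b c VL HState.C HState.C HState.C := by
  unfold Wsym
  rw [Wt_CCC_eq p ends o a₁ a₂ a₃ b c h]
  have hQ := prob_nonneg hp (avoidAll ends a₁ {c})
  have b1 := bhk_cross_cluster_avoid p hp ends a₁ c (X := {c}) (Finset.mem_singleton_self c)
    (isUpperSet_mem_setOf o) (isUpperSet_mem_setOf b)
  have b2 := bhk_cross_cluster_avoid p hp ends a₁ c (X := {c}) (Finset.mem_singleton_self c)
    (isUpperSet_mem_setOf b) (isUpperSet_mem_setOf o)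
  rw [← connEvent_eq_clusterInEvent ends a₁ o, ← connEvent_eq_clusterInEvent ends c b] at b1
  rw [← connEvent_eq_clusterInEvent ends a₁ b, ← connEvent_eq_clusterInEvent ends c o] at b2
  have r1 : connEvent ends a₁ o ∩ connEvent ends c b ∩ avoidAll ends a₁ {c} =
      avoidAll ends a₁ {c} ∩ connEvent ends a₁ o ∩ connEvent ends c b := by
    ext ω; simp only [Set.mem_inter_iff]; tauto
  have r2 : connEvent ends a₁ b ∩ connEvent ends c o ∩ avoidAll ends a₁ {c} =
      avoidAll ends a₁ {c} ∩ connEvent ends c o ∩ connEvent ends a₁ b := by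
    ext ω; simp only [Set.mem_inter_iff]; tauto
  rw [r1, Set.inter_comm (connEvent ends a₁ o), Set.inter_comm (connEvent ends c b)] at b1
  rw [r2, Set.inter_comm (connEvent ends a₁ b), Set.inter_comm (connEvent ends c o)] at b2
  nlinarith [b1, b2, hQ, mul_nonneg hQ hQ]

end PieceCCC

end RootBridge

end CovForm

end Summit.Ventures.PercRepro2
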